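import Summits.BirchSwinnertonDyer.BirchSwinnertonDyer.Theorems.AdditiveBranchIMCTameWaldspurgerDisplay
import Summits.BirchSwinnertonDyer.BirchSwinnertonDyer.Theorems.UniversalToricDescentWildSplitWaldspurgerAtThreeFlat
import Literature.NumberTheory.EllipticCurves.Hsieh2014.AnticyclotomicPAdicLFunctionRamifiedSteinberg
import HarnessLib

/-!
# Route `AdditiveBranchIMC`, cruxes `GordTwoRankZeroOffCaseOne` (19357), `MultLower` (19359), `GordTwoRankOne` (19358):
# the VALUE HALF of the shared BRANCH SOCKET, part 2 — over a tame-road field (one `K`-ramified Steinberg prime) a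
# ♭-frame `Q ∈ 𝓞_{ℂ_p}⟦T⟧` with Castella's interpolation property (`R1.IsBDPLFunctionInt`) EXISTS at every embedding
# datum inducing `𝔭` (Hsieh 2014 Thm. A with one ramified Steinberg prime), and EVERY such frame has the value
# `Q(𝟙) = u·(log_{ω_E} P / c)²`, `‖u‖ = 1` EXACTLY, the Manin constant `c = Dt.c` KEPT

Prover seat `cruxlead-19357` (gen 5), cell `bsd-addord`, 2026-08-29. HONEST FRAMING: THEOREMS ONLY (0 definitions,
0 named facts, 0 `sorry`); everything is CONDITIONAL on the two displayed refereed inputs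

* `hA : Hsieh2014.thmA_exists_isHsiehLFunction_unrPeriod_ramifiedSteinberg` (Hsieh, Doc. Math. 19 (2014) Thm. A with
  `𝔫⁻ = 𝔮` one `K`-ramified Steinberg prime, typed p637501; conjunct 23 of the tame lines' printed-facts conjunctions);
* `hL : LiuZhangZhang2018.thm151_thm153_modularCurve_heegnerVector_additive_ramifiedSteinberg` (Liu–Zhang–Zhang 2018
  Thm 1.5.1 ∧ 1.5.3 at `p² ∣ N` with one `K`-ramified Steinberg prime, typed p638196; conjunct 15);

and BSD is proved for no curve by any of this. VERBATIM PORT of seat `bsd-potss-kmc`'s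
`UniversalToricDescentWaldspurgerFlat.intSeries_value_of_frame_manin` / `exists_frameInt_value_manin`
(`Theorems/UniversalToricDescentWildSplitWaldspurgerAtThreeFlat.lean` §2, all-split Heegner hypothesis) to the
ramified-Steinberg configuration: the binder `SatisfiesHeegnerHypothesis N K` is REPLACED by the configuration at a
prime `q` (`q ≠ p`, `q ∣ N`, `q² ∤ N`, `(q : ℤ) ∣ d_K`, `W` multiplicative and not split multiplicative at `q`, every
`ℓ ∣ N`, `ℓ ≠ q` split in `K`) plus `p` split (`((p)).primesOver`-count `2`), and the complex embedding `ι_K` of the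
Heegner datum is assumed to INDUCE `𝔭` along the frame's `ι′` (the conjugation swap is the consumer's, by rank one).

* §1 **`intSeries_value_of_frame_manin_ramifiedSteinberg`** — for EVERY ♭-frame `(Ω_K′ ≠ 0, Ω_p′ ≠ 0, Q′)` at
  `(ι′, 𝔭)`: `Q′(𝟙) = u·(log_ω P / c)²`, `‖u‖ = 1` (X11b's one-sided rigidity
  `intSeries_constantCoeff_eq_of_isBDPLFunctionInt_of_continuousValues` against the continuous display of part 1);
  **`exists_frameInt_value_manin_ramifiedSteinberg`** — such a frame EXISTS (Hsieh A ramified-Steinberg +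
  `X11b.lambdaSupplyAt` + `X11b.exists_isBDPLFunctionInt_of_isHsiehLFunction`).

What this is NOT: not the divisibility half (Wan 2020 Thm 1.1 (1) + PORT-1 — the registered ♭-inclusion stub); not
the socket (part 3); not an `R₀`-frame; nothing booked.

References: [Hsieh2014] Doc. Math. 19 (2014) Thm. A (= arXiv:1112.1580 Thm. 1), §3.5 (R1); [LiuZhangZhang2018]
Duke Math. J. 167 (2018) Thm 1.5.1, Remark 1.1.2, Thm 1.5.3; [Castella2018] Thms. 3.1–3.2 (shapes); [CaiShuTian2014]
Prop 3.12; [EdixhovenManin1991] §1.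
-/

set_option autoImplicit false

-- D-0017 layout: summit = sub-problem, so `Summit.BirchSwinnertonDyer.BirchSwinnertonDyer.…` is the
-- mandated namespace of Theorems files (same option as the route's sibling Theorems files).
set_option linter.dupNamespace false

noncomputable section

open scoped Classical MatrixGroups ModularForm Topology NumberField

namespace Summit.BirchSwinnertonDyer.BirchSwinnertonDyer.Theorems.TameWaldspurger

open Filter CongruenceSubgroup WeierstrassCurve NumberField IsDedekindDomain Field PowerSeries
  Literature.NumberTheory.EllipticCurves Literature.NumberTheory.EllipticCurves.ModularForms
  Literature.NumberTheory.EllipticCurves.LiuZhangZhang2018 Literature.NumberTheory.EllipticCurves.Rank1Residual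
  Literature.NumberTheory.GaloisRepresentations
  Summit.BirchSwinnertonDyer.Rank1Residual Summit.BirchSwinnertonDyer.Rank1Residual.X11b
  Summit.BirchSwinnertonDyer.Rank1Residual.X11b.Halves Summit.BirchSwinnertonDyer.Rank1Residual.X2

/-! ### §1 The value of EVERY ♭-frame at the trivial character, and the existence of a ♭-frame -/

section Frame

variable {p : ℕ} [Fact p.Prime]

/-- **The value at `𝟙` of every ♭-frame at an additive prime over a tame-road field, Manin constant kept.** For `W/ℚ`
globally minimal with `p² ∣ N_W` (`p` odd, split in `K`), `K` imaginary quadratic with `d_K < −4` in the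
ramified-Steinberg configuration at `q` (`q ≠ p`, `q ‖ N`, `q ∣ d_K`, `a_q = −1`, every other `ℓ ∣ N` split), a Heegner
datum `(Dt, H, ι_K, P)` with `P` of INFINITE order whose complex embedding `ι_K` induces `𝔭` along `ι′`, `(κ, γ)`
anticyclotomic, a degree-one prime `𝔭 ∋ p`, the embedding datum `ι′` inducing `𝔭` and ANY newform `f` of `W`: EVERY
♭-frame `(Ω_K′ ≠ 0, Ω_p′ ≠ 0, Q′ ∈ 𝓞_{ℂ_p}⟦T⟧)` with `R1.IsBDPLFunctionInt p ι′ 𝔭 κ γ f Ω_K′ Ω_p′ Q′` has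
`Q′(𝟙) = u·(log_{ω_E} P / c)²` with `‖u‖ = 1` (`log` at `embAt K p 𝔭`). CONDITIONAL on `hL`; no `R₀`, image or
rank hypothesis. [cite: LiuZhangZhang2018, Thm 1.5.1 and Thm 1.5.3 (Duke Math. J. 167 pp. 748–749)]
[cite: Castella2018, Thm. 3.1–3.2 (arXiv:1704.06608 pp. 8–9) (shapes)] -/
theorem intSeries_value_of_frame_manin_ramifiedSteinberg
    (hL : thm151_thm153_modularCurve_heegnerVector_additive_ramifiedSteinberg)
    (W : WeierstrassCurve ℚ) [W.IsElliptic] [W.IsGloballyMinimal]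
    (K : Type) [Field K] [NumberField K] (𝔭 : HeightOneSpectrum (𝓞 K))
    (κ : ZpExtension K p) (γ : absoluteGaloisGroup K) [Fact (κ.IsTopGenerator γ)] {N : ℕ} [NeZero N]
    (Dt : ModularParametrizationData W N) (H : HeegnerDatum N (NumberField.discr K))
    (ιK : K →+* ℂ) (P : (W.baseChange K).toAffine.Point)
    (f : CuspForm (CongruenceSubgroup.Gamma0 N) 2) (hfW : IsNewformOf W f) (q : ℕ) [Fact q.Prime]
    (hp2 : p ≠ 2) (hN : W.conductorNorm ℤ = N) (hp2N : p ^ 2 ∣ N) (hK : IsImaginaryQuadratic K)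
    (hd4 : NumberField.discr K < -4) (hsplit : ((Ideal.span {(p : ℤ)}).primesOver (𝓞 K)).ncard = 2)
    (h𝔭 : ((p : ℕ) : 𝓞 K) ∈ 𝔭.asIdeal) (he : 𝔭.asIdeal.ramificationIdx (𝓞 ℚ) = 1)
    (hf : 𝔭.asIdeal.inertiaDeg (𝓞 ℚ) = 1)
    (hqp : q ≠ p) (hqN : q ∣ N) (hq2 : ¬ q ^ 2 ∣ N) (hqd : (q : ℤ) ∣ NumberField.discr K)
    (hmult : W.HasMultiplicativeReductionAtPrime q) (hns : ¬ W.HasSplitMultiplicativeReductionAtPrime q)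
    (hsplitq : ∀ ℓ : ℕ, ℓ.Prime → ℓ ∣ N → ℓ ≠ q → ((Ideal.span {(ℓ : ℤ)}).primesOver (𝓞 K)).ncard = 2)
    (hκ : κ.IsAnticyclotomic)
    (hP : WeierstrassCurve.Affine.Point.map ιK.toRatAlgHom P = heegnerPointComplex Dt H)
    (hPinf : ¬ IsOfFinAddOrder P)
    (ι' : PadicAlgCl p ≃+* ℂ)
    (hι' : ∀ (w : InfinitePlace K) (k : 𝓞 K), k ∈ 𝔭.asIdeal ↔ ‖ι'.symm (w.embedding (k : K))‖ < 1)
    (hιK : ∀ k : 𝓞 K, k ∈ 𝔭.asIdeal ↔ ‖ι'.symm (ιK (k : K))‖ < 1)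
    {ΩK' : ℂ} {Ωp' : ℂ_[p]} {Q' : PowerSeries (PadicComplexInt p)} (hΩK' : ΩK' ≠ 0) (hΩp' : Ωp' ≠ 0)
    (hQ' : R1.IsBDPLFunctionInt p ι' 𝔭 κ γ f ΩK' Ωp' Q') :
    ∃ u : ℂ_[p], ‖u‖ = 1 ∧ IntSeries.HasValueAt Q' 0
      (u * (algebraMap ℚ_[p] ℂ_[p] (logOmega W p (embAt K p 𝔭 h𝔭 he hf) P / (Dt.c : ℚ_[p]))) ^ 2) := by
  have hγ : κ.IsTopGenerator γ := Fact.out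
  set e : K →+* ℚ_[p] := embAt K p 𝔭 h𝔭 he hf with hedef
  have hemb : ∀ k : 𝓞 K, k ∈ 𝔭.asIdeal ↔ ‖e (k : K)‖ < 1 := mem_asIdeal_iff_norm_embAt_lt_one 𝔭 h𝔭 he hf
  -- the continuous display (LZZ road over the tame-road field, Manin-robust) at the embedding of the frame's prime
  obtain ⟨Ωp₀, u, hΩp₀, hu, hcont⟩ :=
    exists_continuousDisplay_manin_ramifiedSteinberg hL ι' W K 𝔭 κ γ Dt H ιK e P f q hp2 hN hp2N hK hd4 hsplit h𝔭
      hι' hιK hqp hqN hq2 hqd hmult hns hsplitq hκ hγ hfW hP hemb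
  have hlog : Castella2018.padicLogOmega W p e P = logOmega W p e P := (R1.logOmega_eq_padicLogOmega W p e P).symm
  rw [hlog] at hcont
  -- the limit is non-zero: `P` of infinite order, `c ≠ 0`, `‖u‖ = 1`
  have hlogne : logOmega W p e P ≠ 0 := R1.logOmega_ne_zero W p e hPinf
  have hcZ : Dt.c ≠ 0 := Dt.maninConstant_ne_zero_holds
  have hcQ : (Dt.c : ℚ_[p]) ≠ 0 := by exact_mod_cast hcZ
  have hu0 : u ≠ 0 := fun h0 ↦ by rw [h0, norm_zero] at hu; exact zero_ne_one hu
  have hc0 : u * (algebraMap ℚ_[p] ℂ_[p] (logOmega W p e P / (Dt.c : ℚ_[p]))) ^ 2 ≠ 0 :=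
    mul_ne_zero hu0 (pow_ne_zero _ ((map_ne_zero _).mpr (div_ne_zero hlogne hcQ)))
  have heq := intSeries_constantCoeff_eq_of_isBDPLFunctionInt_of_continuousValues hp2 hK hκ hγ one_ne_zero
    hΩK' hΩp₀ hΩp' hcont hc0 hQ'
  refine ⟨u, hu, ?_⟩
  rw [← heq]
  exact R1.intSeries_hasValueAt_zero p Q'

/-- **A ♭-frame EXISTS over a tame-road field** (no Heegner datum involved): for every embedding datum `ι′`
inducing `𝔭`, Hsieh 2014 Thm. A with one `K`-ramified Steinberg prime (`hA`) gives `Ω_K ≠ 0`, `Ω_p ∈ R₀ˣ` and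
`Q ∈ 𝓞_{ℂ_p}⟦T⟧` with `R1.IsBDPLFunctionInt p ι′ 𝔭 κ γ f Ω_K Ω_p Q` for any newform `f` of `W` of level `N`,
`p ∣ N` (λ-supply `X11b.lambdaSupplyAt`, glue `X11b.exists_isBDPLFunctionInt_of_isHsiehLFunction`). CONDITIONAL on
`hA`. [cite: Hsieh2014, Thm. A p. 712 (Doc. Math. 19) = Thm. 1 (arXiv:1112.1580 pp. 3–4), §3.5 (R1) (p. 11)]
[cite: Castella2018, Thm. 3.1 (arXiv:1704.06608 p. 9) (shape)] -/
theorem exists_frameInt_ramifiedSteinberg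
    (hA : Hsieh2014.thmA_exists_isHsiehLFunction_unrPeriod_ramifiedSteinberg)
    (W : WeierstrassCurve ℚ) [W.IsElliptic]
    (K : Type) [Field K] [NumberField K] (𝔭 : HeightOneSpectrum (𝓞 K))
    (κ : ZpExtension K p) (γ : absoluteGaloisGroup K) [Fact (κ.IsTopGenerator γ)] {N : ℕ} [NeZero N]
    (f : CuspForm (CongruenceSubgroup.Gamma0 N) 2) (hfW : IsNewformOf W f) (q : ℕ) [Fact q.Prime]
    (hp2 : p ≠ 2) (hpN : p ∣ N) (hK : IsImaginaryQuadratic K)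
    (hsplit : ((Ideal.span {(p : ℤ)}).primesOver (𝓞 K)).ncard = 2)
    (h𝔭 : ((p : ℕ) : 𝓞 K) ∈ 𝔭.asIdeal)
    (hqp : q ≠ p) (hqN : q ∣ N) (hq2 : ¬ q ^ 2 ∣ N) (hqd : (q : ℤ) ∣ NumberField.discr K)
    (hmult : W.HasMultiplicativeReductionAtPrime q) (hns : ¬ W.HasSplitMultiplicativeReductionAtPrime q)
    (hsplitq : ∀ ℓ : ℕ, ℓ.Prime → ℓ ∣ N → ℓ ≠ q → ((Ideal.span {(ℓ : ℤ)}).primesOver (𝓞 K)).ncard = 2)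
    (hκ : κ.IsAnticyclotomic) (ι' : PadicAlgCl p ≃+* ℂ)
    (hι' : ∀ (w : InfinitePlace K) (k : 𝓞 K), k ∈ 𝔭.asIdeal ↔ ‖ι'.symm (w.embedding (k : K))‖ < 1) :
    ∃ (ΩK : ℂ) (Ωp : (unrIntegers p)ˣ) (Q : PowerSeries (PadicComplexInt p)), ΩK ≠ 0 ∧
      R1.IsBDPLFunctionInt p ι' 𝔭 κ γ f ΩK ((Ωp : unrIntegers p) : ℂ_[p]) Q := by
  have hγ : κ.IsTopGenerator γ := Fact.out
  obtain ⟨lam, rlam, hunit, hinfl, hAQ, hunrl, havl, hfacl⟩ := lambdaSupplyAt hp2 ι' K κ hK hκ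
  obtain ⟨A, ΩK₀, C, Ωp, Q₀, hA0, hΩK₀, hC, hQ₀⟩ :=
    hA ι' K 𝔭 κ γ W f q lam rlam hp2 hfW hK hsplit h𝔭 hι' hqp hqN hq2 hqd hmult hns hsplitq hunit
      hinfl hAQ hunrl havl hfacl hκ hγ
  obtain ⟨ΩK, c, hΩK, -, hQ⟩ :=
    exists_isBDPLFunctionInt_of_isHsiehLFunction ι' 𝔭 κ γ f hpN hA0 hΩK₀ hC
      ((Ωp : unrIntegers p) : ℂ_[p]) hQ₀
  exact ⟨ΩK, Ωp, _, hΩK, hQ⟩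

/-- Units of `R₀` are non-zero in `ℂ_p` (norm one). [folklore] -/
theorem coe_units_unrIntegers_ne_zero (Ωp : (unrIntegers p)ˣ) : ((Ωp : unrIntegers p) : ℂ_[p]) ≠ 0 := by
  intro h0
  have h1 := norm_coe_units_unrIntegers p Ωp
  rw [h0, norm_zero] at h1
  exact zero_ne_one h1

/-- **A ♭-frame EXISTS at every additive datum over a tame-road field and has the value** (`∃`-form): for every
embedding datum `ι′` inducing `𝔭` (and the datum's complex embedding inducing `𝔭` along `ι′`),
`exists_frameInt_ramifiedSteinberg` gives the frame and `intSeries_value_of_frame_manin_ramifiedSteinberg` its value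
`u·(log_ω P / c)²`, `‖u‖ = 1`, at `𝟙`. CONDITIONAL on `hA` and `hL`.
[cite: Hsieh2014, Thm. A p. 712 (Doc. Math. 19) = Thm. 1 (arXiv:1112.1580 pp. 3–4), §3.5 (R1) (p. 11)]
[cite: LiuZhangZhang2018, Thm 1.5.1 and Thm 1.5.3 (Duke Math. J. 167 pp. 748–749)] -/
theorem exists_frameInt_value_manin_ramifiedSteinberg
    (hA : Hsieh2014.thmA_exists_isHsiehLFunction_unrPeriod_ramifiedSteinberg)
    (hL : thm151_thm153_modularCurve_heegnerVector_additive_ramifiedSteinberg)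
    (W : WeierstrassCurve ℚ) [W.IsElliptic] [W.IsGloballyMinimal]
    (K : Type) [Field K] [NumberField K] (𝔭 : HeightOneSpectrum (𝓞 K))
    (κ : ZpExtension K p) (γ : absoluteGaloisGroup K) [Fact (κ.IsTopGenerator γ)] {N : ℕ} [NeZero N]
    (Dt : ModularParametrizationData W N) (H : HeegnerDatum N (NumberField.discr K))
    (ιK : K →+* ℂ) (P : (W.baseChange K).toAffine.Point) (q : ℕ) [Fact q.Prime]
    (hp2 : p ≠ 2) (hN : W.conductorNorm ℤ = N) (hp2N : p ^ 2 ∣ N) (hK : IsImaginaryQuadratic K)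
    (hd4 : NumberField.discr K < -4) (hsplit : ((Ideal.span {(p : ℤ)}).primesOver (𝓞 K)).ncard = 2)
    (h𝔭 : ((p : ℕ) : 𝓞 K) ∈ 𝔭.asIdeal) (he : 𝔭.asIdeal.ramificationIdx (𝓞 ℚ) = 1)
    (hf : 𝔭.asIdeal.inertiaDeg (𝓞 ℚ) = 1)
    (hqp : q ≠ p) (hqN : q ∣ N) (hq2 : ¬ q ^ 2 ∣ N) (hqd : (q : ℤ) ∣ NumberField.discr K)
    (hmult : W.HasMultiplicativeReductionAtPrime q) (hns : ¬ W.HasSplitMultiplicativeReductionAtPrime q)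
    (hsplitq : ∀ ℓ : ℕ, ℓ.Prime → ℓ ∣ N → ℓ ≠ q → ((Ideal.span {(ℓ : ℤ)}).primesOver (𝓞 K)).ncard = 2)
    (hκ : κ.IsAnticyclotomic)
    (hP : WeierstrassCurve.Affine.Point.map ιK.toRatAlgHom P = heegnerPointComplex Dt H)
    (hPinf : ¬ IsOfFinAddOrder P)
    (ι' : PadicAlgCl p ≃+* ℂ)
    (hι' : ∀ (w : InfinitePlace K) (k : 𝓞 K), k ∈ 𝔭.asIdeal ↔ ‖ι'.symm (w.embedding (k : K))‖ < 1)
    (hιK : ∀ k : 𝓞 K, k ∈ 𝔭.asIdeal ↔ ‖ι'.symm (ιK (k : K))‖ < 1) :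
    ∃ (ΩK : ℂ) (Ωp : (unrIntegers p)ˣ) (Q : PowerSeries (PadicComplexInt p)), ΩK ≠ 0 ∧
      R1.IsBDPLFunctionInt p ι' 𝔭 κ γ Dt.f ΩK ((Ωp : unrIntegers p) : ℂ_[p]) Q ∧
      ∃ u : ℂ_[p], ‖u‖ = 1 ∧ IntSeries.HasValueAt Q 0
        (u * (algebraMap ℚ_[p] ℂ_[p] (logOmega W p (embAt K p 𝔭 h𝔭 he hf) P / (Dt.c : ℚ_[p]))) ^ 2) := by
  subst hN
  have hpN : p ∣ W.conductorNorm ℤ := dvd_trans (dvd_pow_self p two_ne_zero) hp2N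
  obtain ⟨ΩK, Ωp, Q, hΩK, hQ⟩ := exists_frameInt_ramifiedSteinberg hA W K 𝔭 κ γ Dt.f Dt.isNewformOf q hp2 hpN hK
    hsplit h𝔭 hqp hqN hq2 hqd hmult hns hsplitq hκ ι' hι'
  refine ⟨ΩK, Ωp, Q, hΩK, hQ, ?_⟩
  exact intSeries_value_of_frame_manin_ramifiedSteinberg hL W K 𝔭 κ γ Dt H ιK P Dt.f Dt.isNewformOf q hp2 rfl hp2N
    hK hd4 hsplit h𝔭 he hf hqp hqN hq2 hqd hmult hns hsplitq hκ hP hPinf ι' hι' hιK hΩK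
    (coe_units_unrIntegers_ne_zero Ωp) hQ

end Frame

/-! ### §2 Any complex embedding of the Heegner datum, in rank one -/

section RankOne

variable {p : ℕ} [Fact p.Prime]

/-- **The value at `𝟙` of every ♭-frame, for ANY complex embedding of the Heegner datum, when `rank E(K) = 1`.**
`intSeries_value_of_frame_manin_ramifiedSteinberg` asks the datum's embedding `ι_K` to induce `𝔭` along `ι′`; for an
arbitrary `ι_K` write `ι_K = w₀.embedding ∘ τ` with `τ ∈ Gal(K/ℚ)` an involution
(`ComplexEmbedding.exists_comp_symm_eq_of_comp_eq`), pass to the Galois-conjugate point `τ_* P` (again over the traced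
Heegner point through `w₀.embedding`, again of infinite order), and return by `(log_{ω_E} τ_* P)² = (log_{ω_E} P)²`
(`X11b.R1.sq_logOmega_map_eq_of_rank_one`: `τ_* P = ±P + torsion` in rank one). Same conclusion, same unit.
[cite: LiuZhangZhang2018, Thm 1.5.1 and Thm 1.5.3 (Duke Math. J. 167 pp. 748–749)]
[cite: SilvermanAEC2009, VIII.6.7 and IV.6.4 (the logarithm kills torsion)] -/
theorem intSeries_value_of_frame_manin_ramifiedSteinberg_of_rank_one
    (hL : thm151_thm153_modularCurve_heegnerVector_additive_ramifiedSteinberg)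
    (W : WeierstrassCurve ℚ) [W.IsElliptic] [W.IsGloballyMinimal]
    (K : Type) [Field K] [NumberField K] (𝔭 : HeightOneSpectrum (𝓞 K))
    (κ : ZpExtension K p) (γ : absoluteGaloisGroup K) [Fact (κ.IsTopGenerator γ)] {N : ℕ} [NeZero N]
    (Dt : ModularParametrizationData W N) (H : HeegnerDatum N (NumberField.discr K))
    (ιK : K →+* ℂ) (P : (W.baseChange K).toAffine.Point)
    (f : CuspForm (CongruenceSubgroup.Gamma0 N) 2) (hfW : IsNewformOf W f) (q : ℕ) [Fact q.Prime]
    (hp2 : p ≠ 2) (hN : W.conductorNorm ℤ = N) (hp2N : p ^ 2 ∣ N) (hK : IsImaginaryQuadratic K)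
    (hd4 : NumberField.discr K < -4) (hsplit : ((Ideal.span {(p : ℤ)}).primesOver (𝓞 K)).ncard = 2)
    (h𝔭 : ((p : ℕ) : 𝓞 K) ∈ 𝔭.asIdeal) (he : 𝔭.asIdeal.ramificationIdx (𝓞 ℚ) = 1)
    (hf : 𝔭.asIdeal.inertiaDeg (𝓞 ℚ) = 1)
    (hqp : q ≠ p) (hqN : q ∣ N) (hq2 : ¬ q ^ 2 ∣ N) (hqd : (q : ℤ) ∣ NumberField.discr K)
    (hmult : W.HasMultiplicativeReductionAtPrime q) (hns : ¬ W.HasSplitMultiplicativeReductionAtPrime q)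
    (hsplitq : ∀ ℓ : ℕ, ℓ.Prime → ℓ ∣ N → ℓ ≠ q → ((Ideal.span {(ℓ : ℤ)}).primesOver (𝓞 K)).ncard = 2)
    (hκ : κ.IsAnticyclotomic)
    (hP : WeierstrassCurve.Affine.Point.map ιK.toRatAlgHom P = heegnerPointComplex Dt H)
    (hPinf : ¬ IsOfFinAddOrder P) (hrk : (W.baseChange K).mordellWeilRank = 1)
    (ι' : PadicAlgCl p ≃+* ℂ)
    (hι' : ∀ (w : InfinitePlace K) (k : 𝓞 K), k ∈ 𝔭.asIdeal ↔ ‖ι'.symm (w.embedding (k : K))‖ < 1)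
    {ΩK' : ℂ} {Ωp' : ℂ_[p]} {Q' : PowerSeries (PadicComplexInt p)} (hΩK' : ΩK' ≠ 0) (hΩp' : Ωp' ≠ 0)
    (hQ' : R1.IsBDPLFunctionInt p ι' 𝔭 κ γ f ΩK' Ωp' Q') :
    ∃ u : ℂ_[p], ‖u‖ = 1 ∧ IntSeries.HasValueAt Q' 0
      (u * (algebraMap ℚ_[p] ℂ_[p] (logOmega W p (embAt K p 𝔭 h𝔭 he hf) P / (Dt.c : ℚ_[p]))) ^ 2) := by
  haveI hEK : (W.baseChange K).IsElliptic := by rw [baseChange]; infer_instance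
  -- one infinite place; the datum's complex embedding is `w₀.embedding ∘ τ` for an involution `τ ∈ Gal(K/ℚ)`
  obtain ⟨w₀⟩ := (inferInstance : Nonempty (InfinitePlace K))
  haveI : IsGalois ℚ K := by
    haveI : Algebra.IsQuadraticExtension ℚ K := ⟨hK.1⟩
    infer_instance
  obtain ⟨σ, hσ⟩ := ComplexEmbedding.exists_comp_symm_eq_of_comp_eq (k := ℚ) w₀.embedding ιK
    (by ext x; simp)
  set τ : K →+* K := ((σ.symm : K ≃ₐ[ℚ] K) : K →+* K) with hτdef
  have hτ : ∀ x, τ (τ x) = x := by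
    intro x
    have hcard : Nat.card (K ≃ₐ[ℚ] K) = 2 := by rw [IsGalois.card_aut_eq_finrank, hK.1]
    have hsq : σ.symm * σ.symm = 1 := by
      have h := pow_card_eq_one' (G := K ≃ₐ[ℚ] K) (x := σ.symm)
      rwa [hcard, pow_two] at h
    have := congrArg (fun g : K ≃ₐ[ℚ] K ↦ g x) hsq
    simpa [hτdef, AlgEquiv.mul_apply] using this
  -- the Galois conjugate `P' = τ_* P` is the Heegner point read through `w₀.embedding`
  set P' := WeierstrassCurve.Affine.Point.map τ.toRatAlgHom P with hP'def
  have hP' : WeierstrassCurve.Affine.Point.map w₀.embedding.toRatAlgHom P' =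
      heegnerPointComplex Dt H := by
    rw [hP'def, WeierstrassCurve.Affine.Point.map_map]
    have hcomp : w₀.embedding.toRatAlgHom.comp τ.toRatAlgHom = ιK.toRatAlgHom := by
      apply AlgHom.ext
      intro x
      have := RingHom.congr_fun hσ x
      simpa [hτdef] using this
    rw [hcomp]
    exact hP
  -- `τ_* τ_* Q = Q`, so `P'` has infinite order
  have hff : ∀ Q : (W.baseChange K).toAffine.Point,
      WeierstrassCurve.Affine.Point.map τ.toRatAlgHom (WeierstrassCurve.Affine.Point.map τ.toRatAlgHom Q) = Q := by
    rintro (_ | ⟨x, y, hxy⟩)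
    · rfl
    · simp only [WeierstrassCurve.Affine.Point.map_some]
      congr 1 <;> exact hτ _
  have hP'inf : ¬ IsOfFinAddOrder P' := by
    intro h
    apply hPinf
    rw [← hff P]
    exact (WeierstrassCurve.Affine.Point.map (W' := W) τ.toRatAlgHom).isOfFinAddOrder h
  -- the value at `τ_* P` (the embedding `w₀.embedding` induces `𝔭` along `ι′`), then at `P` by rank one
  obtain ⟨u, hu, hval⟩ := intSeries_value_of_frame_manin_ramifiedSteinberg hL W K 𝔭 κ γ Dt H w₀.embedding P' f
    hfW q hp2 hN hp2N hK hd4 hsplit h𝔭 he hf hqp hqN hq2 hqd hmult hns hsplitq hκ hP' hP'inf ι' hι' (hι' w₀)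
    hΩK' hΩp' hQ'
  refine ⟨u, hu, ?_⟩
  have key : ∀ x : ℚ_[p], (algebraMap ℚ_[p] ℂ_[p] (x / (Dt.c : ℚ_[p]))) ^ 2 =
      algebraMap ℚ_[p] ℂ_[p] (x ^ 2 / (Dt.c : ℚ_[p]) ^ 2) := fun x ↦ by rw [← map_pow, div_pow]
  rw [key, ← R1.sq_logOmega_map_eq_of_rank_one W p (embAt K p 𝔭 h𝔭 he hf) τ hτ hrk hPinf, ← key]
  exact hval

end RankOne



end Summit.BirchSwinnertonDyer.BirchSwinnertonDyer.Theorems.TameWaldspurger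

end
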